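import HarnessLib
import Summits.RiemannHypothesis.RiemannHypothesis.Theorems.SignConePointwiseCheckerFast

/-!
# Route SignCone: soundness of the fast pointwise-certificate checker

Support for the unconditional rungs of `SignConeOscillatory` / `SignConeInequality`
(items stmt-RiemannHypothesis-16302 / 16301). Soundness of the checks of
`SignConePointwiseCheckerFast.lean` for the density `F_D` of `SignConePointwiseCheckerDefs.lean`:

* `point_bound`: a point `u` where `flT` returns `f` (genuine tables) has `f − slope·|y − u| ≤ F_D(y)`
  for every `y` with `w ≤ Re ψ(1/4 + iy/2)` — enclosures of `Ê_χ(u)` (one-pass knot values) and of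
  the comb, Lipschitz constants of `Ê_χ` and of the comb;
* `gridFrom_sound` (two-point cells: `2F_D(y) ≥ f_u + f_v − S(v − u)` on `[u, v]`), `agrid₂_sound`
  (the anchor: `w ≤ wLoQ(u₀) ≤ Re ψ` and monotonicity in `|y|`), `chain₂_sound`;
* **`PWData.F_nonneg_of_checks₂`**: scalar checks for `Y₀` + tables check + anchored grids whose
  point lists chain from `0` to `Y₀`, each passing `checkAGrid₂`, imply `∀ y, 0 ≤ F_D(y)`.
-/

noncomputable section

-- `Summit.RiemannHypothesis.RiemannHypothesis.…` repeats a namespace component by design (D-0017 layout).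
set_option linter.dupNamespace false

open Real

namespace Summit.RiemannHypothesis.RiemannHypothesis.Theorems.SignCone

open Literature.Analysis.ValidatedNumerics.Numerics Literature.NumberTheory.LFunctions
open Literature.Analysis.SpecialFunctions (reDigammaQuarter reDigammaQuarter_mono reDigammaQuarter_even)

namespace PWData

variable {D : PWData}

/-- Table lookups are the engine's knot data. [folklore] -/
theorem getD_csTable {k : ℕ} (hk : k ≤ D.d.K) :
    ((List.range (D.d.K + 1)).map D.csAt).getD k (FI.ofInt 0, FI.ofInt 0) = D.csAt k := by
  rw [List.getD_eq_getElem _ _ (by simp; omega), List.getElem_map, List.getElem_range]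

/-- **Point bound.** If `flT` returns `f` at `u` (genuine tables), then for every `y` at which
`w ≤ Re ψ(1/4 + iy/2)`: `f − slope·|y − u| ≤ F_D(y)`. [folklore] -/
theorem point_bound {Y0 : ℚ} (h : D.checkScalars Y0 = true) {cs : List (FI × FI)} {logs : List FI}
    (ht : D.tablesOK cs logs = true) {w u f : ℚ} (hf : D.flT cs logs w u = some f) (y : ℝ)
    (hw : ((w : ℚ) : ℝ) ≤ reDigammaQuarter y) : (f : ℝ) - D.slope * |y - u| ≤ D.F y := by
  obtain ⟨hL, hh, hnd, hall, hlog, -, hslope, -⟩ := check_spec h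
  unfold tablesOK at ht
  rw [Bool.and_eq_true, decide_eq_true_eq, decide_eq_true_eq] at ht
  obtain ⟨hcs, hlogs⟩ := ht
  subst hcs hlogs
  unfold flT at hf
  split at hf
  · rename_i Z0 W hZ hW
    simp only [Option.some.injEq] at hf
    -- (2) log π
    have h2 : Real.log π ≤ ((logPiHi : ℚ) : ℝ) := logPiHi_ge
    -- (3) Ê(u) from the one-pass list of knot values
    have hz0 := CB.mem_expI hZ (FI.mem_ofRat (D.d.L * u))
    have hw0 := CB.mem_expI hW (FI.mem_ofRat (D.d.h * u))
    have hlen : (PW.tfiList u W ((List.range (D.d.K + 1)).map D.csAt) Z0).length = D.d.K + 1 := by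
      rw [PW.length_tfiList]; simp
    have hT : ∀ k ≤ D.d.K, FI.mem (pwT (D.d.knot k) u)
        ((PW.tfiList u W ((List.range (D.d.K + 1)).map D.csAt) Z0).getD k (FI.ofInt 0)) := by
      intro k hk
      refine PW.mem_tfiList_getD hw0 _ Z0 _ hz0 k (by simp; omega) (D.d.knot k) ?_ ?_ ?_
      · rw [getD_csTable hk]; exact (csAt_mem h (by omega)).1.1
      · rw [getD_csTable hk]; exact (csAt_mem h (by omega)).1.2
      · rw [← Complex.exp_nat_mul, ← Complex.exp_add]
        congr 1
        unfold PWKernel.knot; push_cast; ring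
    have h3 : (((PW.ehatFromList D.d (PW.tfiList u W ((List.range (D.d.K + 1)).map D.csAt) Z0)).loQ : ℚ) : ℝ) ≤
        cosTransform D.d.kernelE u := by
      rw [PWKernel.cosTransform_kernelE_eq hL hh]
      exact FI.loQ_le (PW.mem_ehatFromList D.d hlen hT)
    -- (4) Lipschitz constant of Ê from `checkSlope`
    unfold checkSlope lipHi at hslope
    split at hslope
    · rename_i e he
      split at he
      · rename_i Z0' W' CS hZ' hW' hCS
        simp only [Option.some.injEq] at he
        simp only [Bool.and_eq_true, decide_eq_true_eq] at hslope
        obtain ⟨⟨he0, hcs0⟩, hsl⟩ := hslope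
        have hZk' : ∀ k, CB.mem (Complex.exp ((((D.d.absKernel.knot k : ℝ) * (0 : ℚ) : ℝ)) * Complex.I))
            (CB.mul Z0' (PW.cbPow W' k)) := fun k => by
          have := PW.mem_knotTrig hZ' hW' k
          convert this using 3
          rw [PWKernel.absKernel_knot]
          unfold PWKernel.knot; push_cast; ring
        have hEabs : D.d.absKernel.ehatCF 0 ≤
            ((PW.ehatFI D.d.absKernel D.csAt (fun k => CB.mul Z0' (PW.cbPow W' k)) 0).hiQ : ℝ) := by
          have hm := PW.mem_ehatFI D.d.absKernel (cs := D.csAt) (fun k hk => by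
            rw [PWKernel.absKernel_K] at hk
            exact (csAt_mem h (by omega)).1) hZk'
          push_cast at hm
          exact FI.le_hiQ hm
        have hC := (PW.mem_coshSinhFI hCS).1
        have hS := (PW.mem_coshSinhFI hCS).2
        have hX : (0 : ℝ) ≤ D.d.knot D.d.K := PWKernel.knot_nonneg hL hh _
        have hL' : (0 : ℝ) ≤ D.d.L := by exact_mod_cast hL
        have hLip := abs_cosTransform_sub_le (PWKernel.continuous_kernelE D.d)
          (PWKernel.hasCompactSupport_kernelE hh) y u
        have hM1 := PWKernel.integral_abs_mul_abs_kernelE_le_sharp (d := D.d) hL hh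
        have hMe : 2 * (4 * (D.d.L : ℝ) * Real.sinh (D.d.L / 2) - 8 * Real.cosh (D.d.L / 2) + 8) +
            (D.d.knot D.d.K : ℝ) * (D.d.absKernel.ehatCF 0 - 8 * Real.sinh (D.d.L / 2)) ≤ e := by
          rw [← he]
          push_cast
          have h1 := FI.le_hiQ hS
          have h2 := FI.loQ_le hC
          have h3 := FI.loQ_le hS
          nlinarith [mul_le_mul_of_nonneg_left (sub_le_sub hEabs (mul_le_mul_of_nonneg_left h3 (by norm_num : (0:ℝ) ≤ 8))) hX]
        have h4 : cosTransform D.d.kernelE u - (e : ℝ) * |y - u| ≤ cosTransform D.d.kernelE y := by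
          have : |cosTransform D.d.kernelE y - cosTransform D.d.kernelE u| ≤ (e : ℝ) * |y - u| :=
            hLip.trans (mul_le_mul_of_nonneg_right (hM1.trans hMe) (abs_nonneg _))
          linarith [(abs_sub_le_iff.1 this).2]
        -- (5) the comb (the tabled comb is the engine's comb, by `rfl`)
        have hcb := comb_list_bounds hlog D.a D.nodeList hall y u
        rw [← List.sum_toFinset _ hnd, ← List.sum_toFinset _ hnd] at hcb
        have h5 : ((D.nodeList.map fun n => (D.a n : ℝ) * Real.cos ((u : ℝ) * Real.log n)).sum : ℝ) ≤
            (((PW.combFIT D.nodeList D.a (FI.logTable D.logN) u).hiQ : ℚ) : ℝ) := by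
          rw [PW.combFIT_logTable]
          exact FI.le_hiQ (PW.mem_combFI hlog (fun n hn => (hall n hn).2.1) u)
        rw [← List.sum_toFinset _ hnd] at h5
        -- (6) arithmetic
        have he0' : (0 : ℝ) ≤ e := by exact_mod_cast he0
        have hcs0' : (0 : ℝ) ≤ D.combSlopeQ := by exact_mod_cast hcs0
        have hsl' : ((e + D.combSlopeQ : ℚ) : ℝ) ≤ D.slope := by exact_mod_cast hsl
        push_cast at hsl'
        have hf' : ((w - logPiHi + D.s +
            (PW.ehatFromList D.d (PW.tfiList u W ((List.range (D.d.K + 1)).map D.csAt) Z0)).loQ -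
            (PW.combFIT D.nodeList D.a (FI.logTable D.logN) u).hiQ : ℚ) : ℝ) = f := by
          exact_mod_cast hf
        push_cast at hf'
        have ha0 : 0 ≤ |y - (u : ℝ)| := abs_nonneg _
        have hstep : ((e : ℝ) + D.combSlopeQ) * |y - u| ≤ (D.slope : ℝ) * |y - u| :=
          mul_le_mul_of_nonneg_right hsl' ha0
        have ecs : ((List.map (fun n => D.a n * ((FI.logTable D.logN).getD n (FI.ofInt 0)).hiQ) D.nodeList).sum : ℚ) =
            D.combSlopeQ := rfl
        rw [ecs] at hcb
        have hcomb := hcb.1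
        rw [add_mul] at hstep
        unfold F
        linarith [hw, h2, h3, h4, hcomb, h5, hstep, hf']
      · simp at he
    · simp at hslope
  · simp at hf

/-- `lastQ [u] = u`. [folklore] -/
theorem lastQ_singleton (u : ℚ) : lastQ [u] = u := rfl

/-- **Soundness of the two-point cells.** From a point `u` with a genuine point bound `fu`, a
passing `checkGridFrom` covers `[u, lastQ (u :: rest)]` (when there is at least one cell),
provided `w ≤ Re ψ(1/4 + iy/2)` for all `y ≥ u`. [folklore] -/
theorem gridFrom_sound {Y0 : ℚ} (h : D.checkScalars Y0 = true) {cs : List (FI × FI)} {logs : List FI}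
    (ht : D.tablesOK cs logs = true) (w : ℚ) :
    ∀ (rest : List ℚ) (u fu : ℚ), D.flT cs logs w u = some fu →
      (∀ y : ℝ, (u : ℝ) ≤ y → ((w : ℚ) : ℝ) ≤ reDigammaQuarter y) →
      D.checkGridFrom cs logs w u fu rest = true →
      u ≤ lastQ (u :: rest) ∧ ∀ y : ℝ, (u : ℝ) ≤ y → y ≤ lastQ (u :: rest) → rest ≠ [] → 0 ≤ D.F y
  | [], u, _, _, _, _ => ⟨le_of_eq (lastQ_singleton u).symm, fun _ _ _ hne => absurd rfl hne⟩
  | v :: rest, u, fu, hfu, hwu, hg => by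
    simp only [checkGridFrom] at hg
    split at hg
    · rename_i fv hfv
      simp only [Bool.and_eq_true, decide_eq_true_eq] at hg
      obtain ⟨⟨huv, hcell⟩, hrest⟩ := hg
      have huv' : ((u : ℚ) : ℝ) ≤ v := by exact_mod_cast huv
      have hwv : ∀ y : ℝ, (v : ℝ) ≤ y → ((w : ℚ) : ℝ) ≤ reDigammaQuarter y :=
        fun y hy => hwu y (huv'.trans hy)
      have ih := gridFrom_sound h ht w rest v fv hfv hwv hrest
      rw [lastQ_cons_cons]
      refine ⟨huv.trans ih.1, fun y h1 h2 _ => ?_⟩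
      rcases le_or_gt y (v : ℝ) with hyv | hyv
      · -- the two-point cell `[u, v]`
        have pu := point_bound h ht hfu y (hwu y h1)
        have pv := point_bound h ht hfv y (hwu y h1)
        have hc : (((v - u) * D.slope : ℚ) : ℝ) ≤ ((fu + fv : ℚ) : ℝ) := by exact_mod_cast hcell
        push_cast at hc
        rw [abs_of_nonneg (by linarith : (0 : ℝ) ≤ y - u)] at pu
        rw [abs_of_nonpos (by linarith : y - (v : ℝ) ≤ 0)] at pv
        nlinarith [pu, pv, hc]
      · rcases rest with _ | ⟨x, rest'⟩
        · rw [lastQ_singleton] at h2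
          exact absurd h2 (not_le.2 hyv)
        · exact ih.2 y hyv.le h2 (List.cons_ne_nil _ _)
    · simp at hg

/-- **Soundness of a passing anchored grid** `(w, u :: v :: r)`, `0 ≤ u`: `F_D ≥ 0` on
`[u, lastQ]`. [folklore] -/
theorem agrid₂_sound {Y0 : ℚ} (h : D.checkScalars Y0 = true) {cs : List (FI × FI)} {logs : List FI}
    (ht : D.tablesOK cs logs = true) {w : ℚ} {r : List ℚ} {u v : ℚ}
    (hu : 0 ≤ u) (hg : D.checkAGrid₂ cs logs (w, u :: v :: r) = true) :
    u ≤ lastQ (u :: v :: r) ∧ ∀ y : ℝ, (u : ℝ) ≤ y → y ≤ lastQ (u :: v :: r) → 0 ≤ D.F y := by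
  simp only [checkAGrid₂, Bool.and_eq_true, decide_eq_true_eq] at hg
  obtain ⟨hw, hgrid⟩ := hg
  have hu' : (0 : ℝ) ≤ u := by exact_mod_cast hu
  have hwu : ∀ y : ℝ, (u : ℝ) ≤ y → ((w : ℚ) : ℝ) ≤ reDigammaQuarter y := fun y hy => by
    have h1 : ((w : ℚ) : ℝ) ≤ ((wLoQ D.prec u (D.mwAt u) : ℚ) : ℝ) := by exact_mod_cast hw
    exact (h1.trans (wLoQ_le _ _ _)).trans (reDigammaQuarter_mono (by
      rw [abs_of_nonneg hu', abs_of_nonneg (hu'.trans hy)]; exact hy))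
  simp only [checkGrid₂] at hgrid
  split at hgrid
  · rename_i fu hfu
    have hs := gridFrom_sound h ht w (v :: r) u fu hfu hwu hgrid
    exact ⟨hs.1, fun y h1 h2 => hs.2 y h1 h2 (List.cons_ne_nil _ _)⟩
  · simp at hgrid

/-- **Anchored chain soundness.** Anchored grids whose point lists chain from `st ≥ 0` to `Y₀`, all
passing, cover `[st, Y₀]`, and `st ≤ Y₀`. [folklore] -/
theorem chain₂_sound {Y0 : ℚ} (h : D.checkScalars Y0 = true) {cs : List (FI × FI)} {logs : List FI}
    (ht : D.tablesOK cs logs = true) :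
    ∀ (gs : List (ℚ × List ℚ)) (st : ℚ), 0 ≤ st → chainOK (gs.map Prod.snd) st Y0 = true →
      (∀ g ∈ gs, D.checkAGrid₂ cs logs g = true) →
      st ≤ Y0 ∧ ∀ y : ℝ, (st : ℝ) ≤ y → y ≤ Y0 → 0 ≤ D.F y
  | [], st, hst, hch, _ => by
    simp only [List.map_nil, chainOK, decide_eq_true_eq] at hch
    subst hch
    exact ⟨le_rfl, fun y h1 _ => tail_sound h hst y h1⟩
  | (w, pts) :: rest, st, hst, hch, hgs => by
    simp only [List.map_cons, chainOK, Bool.and_eq_true, decide_eq_true_eq] at hch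
    obtain ⟨hhead, hrest⟩ := hch
    have hg : D.checkAGrid₂ cs logs (w, pts) = true := hgs (w, pts) (by simp)
    have hgs' : ∀ g' ∈ rest, D.checkAGrid₂ cs logs g' = true := fun g' hg' => hgs g' (by simp [hg'])
    match pts, hhead, hg with
    | [], hhead, _ => simp at hhead
    | [x], hhead, _ =>
      simp only [List.head?_cons, Option.some.injEq] at hhead
      subst hhead
      have ih := chain₂_sound h ht rest (lastQ [x]) (by simpa [lastQ] using hst) hrest hgs'
      simp only [lastQ] at ih
      exact ih
    | u :: v :: r, hhead, hg =>
      simp only [List.head?_cons, Option.some.injEq] at hhead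
      subst hhead
      have hgr := agrid₂_sound h ht hst hg
      have ih := chain₂_sound h ht rest (lastQ (u :: v :: r)) (hst.trans hgr.1) hrest hgs'
      refine ⟨hgr.1.trans ih.1, fun y h1 h2 => ?_⟩
      rcases le_or_gt y (lastQ (u :: v :: r) : ℝ) with hy | hy
      · exact hgr.2 y h1 hy
      · exact ih.2 y hy.le h2

/-- **Soundness of the fast pointwise checker.** If the scalar checks pass for `Y₀`, the tables
check, and a family of anchored grids whose point lists chain from `0` to `Y₀` passes grid by grid
(two-point cells), then `F_D(y) ≥ 0` for every real `y`. [folklore] -/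
theorem F_nonneg_of_checks₂ {Y0 : ℚ} (h : D.checkScalars Y0 = true) {cs : List (FI × FI)}
    {logs : List FI} (ht : D.tablesOK cs logs = true) (gs : List (ℚ × List ℚ))
    (hch : chainOK (gs.map Prod.snd) 0 Y0 = true) (hgs : ∀ g ∈ gs, D.checkAGrid₂ cs logs g = true)
    (y : ℝ) : 0 ≤ D.F y := by
  wlog hy : 0 ≤ y generalizing y with H
  · have := H (-y) (by linarith); rwa [F_neg] at this
  have hc := chain₂_sound h ht gs 0 le_rfl hch hgs
  rcases le_or_gt y (Y0 : ℝ) with hyY | hyY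
  · exact hc.2 y (by exact_mod_cast hy) hyY
  · exact tail_sound h hc.1 y hyY.le

/-- **Point bound from any certified comb bound.** For engine values `Z₀ ∋ e^{iLu}`, `W ∋ e^{ihu}` and any
upper bound `cU` of the comb at `u`, for every `y` with `w ≤ Re ψ(1/4 + iy/2)`:
`(w − (log π)⁺ + s + Ê_lo(u) − cU) − slope·|y − u| ≤ F_D(y)` (the proof of `point_bound` with the comb
enclosure abstracted; used by faster evaluators of the comb). [folklore] -/
theorem point_bound_of_comb_le {Y0 : ℚ} (h : D.checkScalars Y0 = true) {w u : ℚ} {Z0 W : CB}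
    (hZ : CB.expI (FI.ofRat (D.d.L * u)) = some Z0) (hW : CB.expI (FI.ofRat (D.d.h * u)) = some W) {cU : ℚ}
    (hcu : ∑ n ∈ D.nodeList.toFinset, (D.a n : ℝ) * Real.cos ((u : ℝ) * Real.log n) ≤ (cU : ℝ)) (y : ℝ)
    (hw : ((w : ℚ) : ℝ) ≤ reDigammaQuarter y) :
    ((w - logPiHi + D.s + (PW.ehatFromList D.d (PW.tfiList u W ((List.range (D.d.K + 1)).map D.csAt) Z0)).loQ -
        cU : ℚ) : ℝ) - D.slope * |y - u| ≤ D.F y := by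
  obtain ⟨hL, hh, hnd, hall, hlog, -, hslope, -⟩ := check_spec h
  · -- (2) log π
    have h2 : Real.log π ≤ ((logPiHi : ℚ) : ℝ) := logPiHi_ge
    -- (3) Ê(u) from the one-pass list of knot values
    have hz0 := CB.mem_expI hZ (FI.mem_ofRat (D.d.L * u))
    have hw0 := CB.mem_expI hW (FI.mem_ofRat (D.d.h * u))
    have hlen : (PW.tfiList u W ((List.range (D.d.K + 1)).map D.csAt) Z0).length = D.d.K + 1 := by
      rw [PW.length_tfiList]; simp
    have hT : ∀ k ≤ D.d.K, FI.mem (pwT (D.d.knot k) u)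
        ((PW.tfiList u W ((List.range (D.d.K + 1)).map D.csAt) Z0).getD k (FI.ofInt 0)) := by
      intro k hk
      refine PW.mem_tfiList_getD hw0 _ Z0 _ hz0 k (by simp; omega) (D.d.knot k) ?_ ?_ ?_
      · rw [getD_csTable hk]; exact (csAt_mem h (by omega)).1.1
      · rw [getD_csTable hk]; exact (csAt_mem h (by omega)).1.2
      · rw [← Complex.exp_nat_mul, ← Complex.exp_add]
        congr 1
        unfold PWKernel.knot; push_cast; ring
    have h3 : (((PW.ehatFromList D.d (PW.tfiList u W ((List.range (D.d.K + 1)).map D.csAt) Z0)).loQ : ℚ) : ℝ) ≤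
        cosTransform D.d.kernelE u := by
      rw [PWKernel.cosTransform_kernelE_eq hL hh]
      exact FI.loQ_le (PW.mem_ehatFromList D.d hlen hT)
    -- (4) Lipschitz constant of Ê from `checkSlope`
    unfold checkSlope lipHi at hslope
    split at hslope
    · rename_i e he
      split at he
      · rename_i Z0' W' CS hZ' hW' hCS
        simp only [Option.some.injEq] at he
        simp only [Bool.and_eq_true, decide_eq_true_eq] at hslope
        obtain ⟨⟨he0, hcs0⟩, hsl⟩ := hslope
        have hZk' : ∀ k, CB.mem (Complex.exp ((((D.d.absKernel.knot k : ℝ) * (0 : ℚ) : ℝ)) * Complex.I))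
            (CB.mul Z0' (PW.cbPow W' k)) := fun k => by
          have := PW.mem_knotTrig hZ' hW' k
          convert this using 3
          rw [PWKernel.absKernel_knot]
          unfold PWKernel.knot; push_cast; ring
        have hEabs : D.d.absKernel.ehatCF 0 ≤
            ((PW.ehatFI D.d.absKernel D.csAt (fun k => CB.mul Z0' (PW.cbPow W' k)) 0).hiQ : ℝ) := by
          have hm := PW.mem_ehatFI D.d.absKernel (cs := D.csAt) (fun k hk => by
            rw [PWKernel.absKernel_K] at hk
            exact (csAt_mem h (by omega)).1) hZk'
          push_cast at hm
          exact FI.le_hiQ hm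
        have hC := (PW.mem_coshSinhFI hCS).1
        have hS := (PW.mem_coshSinhFI hCS).2
        have hX : (0 : ℝ) ≤ D.d.knot D.d.K := PWKernel.knot_nonneg hL hh _
        have hL' : (0 : ℝ) ≤ D.d.L := by exact_mod_cast hL
        have hLip := abs_cosTransform_sub_le (PWKernel.continuous_kernelE D.d)
          (PWKernel.hasCompactSupport_kernelE hh) y u
        have hM1 := PWKernel.integral_abs_mul_abs_kernelE_le_sharp (d := D.d) hL hh
        have hMe : 2 * (4 * (D.d.L : ℝ) * Real.sinh (D.d.L / 2) - 8 * Real.cosh (D.d.L / 2) + 8) +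
            (D.d.knot D.d.K : ℝ) * (D.d.absKernel.ehatCF 0 - 8 * Real.sinh (D.d.L / 2)) ≤ e := by
          rw [← he]
          push_cast
          have h1 := FI.le_hiQ hS
          have h2 := FI.loQ_le hC
          have h3 := FI.loQ_le hS
          nlinarith [mul_le_mul_of_nonneg_left (sub_le_sub hEabs (mul_le_mul_of_nonneg_left h3 (by norm_num : (0:ℝ) ≤ 8))) hX]
        have h4 : cosTransform D.d.kernelE u - (e : ℝ) * |y - u| ≤ cosTransform D.d.kernelE y := by
          have : |cosTransform D.d.kernelE y - cosTransform D.d.kernelE u| ≤ (e : ℝ) * |y - u| :=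
            hLip.trans (mul_le_mul_of_nonneg_right (hM1.trans hMe) (abs_nonneg _))
          linarith [(abs_sub_le_iff.1 this).2]
        -- (5) the comb: Lipschitz (its value at `u` is bounded by the hypothesis `hcu`)
        have hcb := comb_list_bounds hlog D.a D.nodeList hall y u
        rw [← List.sum_toFinset _ hnd, ← List.sum_toFinset _ hnd] at hcb
        have h5 := hcu
        -- (6) arithmetic
        have he0' : (0 : ℝ) ≤ e := by exact_mod_cast he0
        have hcs0' : (0 : ℝ) ≤ D.combSlopeQ := by exact_mod_cast hcs0
        have hsl' : ((e + D.combSlopeQ : ℚ) : ℝ) ≤ D.slope := by exact_mod_cast hsl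
        push_cast at hsl'
        push_cast
        have ha0 : 0 ≤ |y - (u : ℝ)| := abs_nonneg _
        have hstep : ((e : ℝ) + D.combSlopeQ) * |y - u| ≤ (D.slope : ℝ) * |y - u| :=
          mul_le_mul_of_nonneg_right hsl' ha0
        have ecs : ((List.map (fun n => D.a n * ((FI.logTable D.logN).getD n (FI.ofInt 0)).hiQ) D.nodeList).sum : ℚ) =
            D.combSlopeQ := rfl
        rw [ecs] at hcb
        have hcomb := hcb.1
        rw [add_mul] at hstep
        unfold F
        linarith [hw, h2, h3, h4, hcomb, h5, hstep]
      · simp at he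
    · simp at hslope


end PWData

end Summit.RiemannHypothesis.RiemannHypothesis.Theorems.SignCone

end
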